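import Summits.ResolutionOfSingularities.ResolutionOfSingularities.Theorems.DeltaCutStellarHypFree
import Summits.ResolutionOfSingularities.ResolutionOfSingularities.Theorems.DeltaCutStellarGuardWild

/-!
# StellarCut T17b — «HypSafe»: the SAFE-FACE ROUND LEMMA for the unit-free hypersurface shape, and the bridge from the tree's
# `IsNCHypStage` in ANY characteristic (lens-6 «barrier-complement carving», g34; 0-weight tool of `DeltaCutStellarWild`)

* §Fibre — `ncHypShapeF.exists_fibre_data'`: the fibre form `X_{l_H}ⁿ + a·X^b` at a point of the centre (T12/T13's construction)
  WITH THE DICHOTOMY the wild guard needs: a HEAVY face (`weightOf E T > n`) has cofactor `a ∈ 𝔪`, a TIGHT face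
  (`weightOf E T = n`) has `b =` the vector of `E`-exponents on `T` (`exists_le_sum_eq` is forced to equality); the SAFE-FACE GUARD
  `ncHypShapeF.not_stalkIdeal_transform_le_sq` — the near-point bound (T10c) fed with `DeltaCutStellarGuardWild.fibreForm_notMem_sq'`
  (heavy ∨ tame ∨ wild); ★ **`ncHypShapeF.transform_of_safe`** (`n ≥ 2`): the shape survives the blow-up of a SAFE face through `H`
  of weight `≥ n`.  T13/T14's tame round lemma `ncHypShape.transform` is the middle disjunct (closing `example` of §Fibre).
* §Bridge — `ncHypShapeF_of_frame`, `ncHypShapeF_of_isBase` (T10's bridge minus the unit: from `IsNCHypStage n` + `IsDatum` +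
  `IsBase` in ANY characteristic); the exponents of the frame list (`weightOf_ofFn`, `NCFrame.expOf_cons_expList`: `0` or a label
  `aᵢ`, the `Dᵢ` having pairwise distinct ideal sheaves); `natCast_stalk_eq_zero_of_charP` (`CharP k p ⇒ p = 0` in the stalks).

0 sorry; axioms standard. [new] [folklore] [cite: Kollar2007, (3.111) Step 3] [cite: CossartPiltant2008, Prop. 4.2 (a)]
[cite: BierstoneGrigorievMilmanWlodarczyk2011, §4 Step 2b]
-/
noncomputable section

open CategoryTheory CategoryTheory.Limits AlgebraicGeometry TopologicalSpace IsLocalRing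
open Literature.AlgebraicGeometry.Resolution

namespace Summit.ResolutionOfSingularities.ResolutionOfSingularities.Theorems.DeltaCutClasses

open Summit.ResolutionOfSingularities.ResolutionOfSingularities.Theorems
open WeakOrderReduction ForcedTowerClasses

/-! ### §Fibre — the fibre form with the HEAVY / TIGHT dichotomy, and the safe-face guard -/

section Fibre

variable {X X' : Scheme.{0}} [IsLocallyNoetherian X] {π : X' ⟶ X} {H : X.IdealSheafData}
  {E : List (X.IdealSheafData × ℕ)} {T : Finset X.IdealSheafData} {n : ℕ} {M : MarkedIdeal X}

omit [IsLocallyNoetherian X] in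
/-- **The fibre form at a point of the centre, WITH THE HEAVY / TIGHT DICHOTOMY.**  At `y ∈ V(C)`, `C = Σ_T K` a face through
`H` of weight `≥ n` of a `ncHypShapeF n`-datum: centre parameters `c` (an rsop part spanning `C_y`, `H_y = (c l_H)`), an exponent
vector `b` of degree `n` with `b l_H = 0`, a cofactor `a` with `eval c (X_{l_H}ⁿ + a·X^b) ∈ 𝓘_y` (T12's construction verbatim),
AND: if the face is HEAVY (`n < weightOf E T`) then `a ∈ 𝔪_y`; if it is TIGHT (`weightOf E T = n`) then every coordinate of `b`
is the `E`-exponent of a member of `T`. [new] [cite: CossartPiltant2008, proof of Prop. 4.2 (a)] [cite: Kollar2007, (3.111) Step 3] -/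
theorem ncHypShapeF.exists_fibre_data' (hEs : HasSNC (H :: boundaryOf E)) (hT : ∀ K ∈ T, K ∈ H :: boundaryOf E) (hHT : H ∈ T)
    (hmT : n ≤ weightOf E T) (hP : ncHypShapeF n X E H M) {y : X} (hy : y ∈ (T.sup id).support) :
    ∃ (k : ℕ) (c : Fin k → X.presheaf.stalk y) (lH : Fin k) (b : Fin k →₀ ℕ) (a : X.presheaf.stalk y),
      IsRsopPart c ∧ Ideal.span (Set.range c) = stalkIdeal (T.sup id) y ∧ stalkIdeal H y = Ideal.span {c lH} ∧
      b lH = 0 ∧ b.degree = n ∧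
      MvPolynomial.eval c (MvPolynomial.X lH ^ n + MvPolynomial.monomial b a) ∈ stalkIdeal M.ideal y ∧
      (n < weightOf E T → a ∈ maximalIdeal (X.presheaf.stalk y)) ∧
      (weightOf E T = n → ∀ l, ∃ K ∈ T, b l = expOf E K) := by
  classical
  haveI : IsRegularLocalRing (X.presheaf.stalk y) := (hEs y).1
  haveI : IsDomain (X.presheaf.stalk y) := isDomain_of_isRegularLocalRing _
  have hyT : ∀ K ∈ T, y ∈ K.support := (mem_support_finsetSup_iff T y).mp hy
  have hyH : y ∈ H.support := hyT H hHT
  obtain ⟨d, z, lab, hz, hlab, hinj⟩ := exists_isRsopPart_lab hEs List.mem_cons_self hyH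
  -- the centre parameters `c = z ∘ e`, `e l = lab (σT⁻¹ l)`
  set σT := T.equivFin with hσT
  let e : Fin T.card → Fin d := fun l => lab (σT.symm l).1
  have he : Function.Injective e := fun l₁ l₂ h =>
    σT.symm.injective (Subtype.ext (hinj _ (hT _ (σT.symm l₁).2) _ (hT _ (σT.symm l₂).2)
      (hyT _ (σT.symm l₁).2) (hyT _ (σT.symm l₂).2) h))
  have hce : ∀ K : ↥T, (z ∘ e) (σT K) = z (lab K.1) := fun K => by
    simp only [Function.comp_apply, e, Equiv.symm_apply_apply]
  have hspan : Ideal.span (Set.range (z ∘ e)) = stalkIdeal (T.sup id) y := by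
    rw [stalkIdeal_finsetSup T y]
    have hsup : (T.sup fun K => stalkIdeal K y) = T.sup fun K => Ideal.span {z (lab K)} :=
      Finset.sup_congr rfl fun K hK => hlab K (hT K hK) (hyT K hK)
    rw [hsup, Finset.sup_span_singleton_eq_span_image]
    congr 1
    ext a
    constructor
    · rintro ⟨l, rfl⟩
      exact ⟨(σT.symm l).1, (σT.symm l).2, rfl⟩
    · rintro ⟨K, hK, rfl⟩
      exact ⟨σT ⟨K, hK⟩, hce ⟨K, hK⟩⟩
  set lH := σT ⟨H, hHT⟩ with hlH
  have hHc : stalkIdeal H y = Ideal.span {(z ∘ e) lH} := by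
    rw [hce ⟨H, hHT⟩]; exact hlab H List.mem_cons_self hyH
  -- the generators of the datum, the monomial as a product of parameters
  obtain ⟨h, m, u, -, hHx, hMx, hIx⟩ := hP.exists_generator hyH
  have hE : ∀ p ∈ E, p.1 ∈ H :: boundaryOf E := fun p hp => List.mem_cons_of_mem _ (fst_mem_boundaryOf hp)
  set g : X.IdealSheafData × ℕ → X.presheaf.stalk y := fun p => if y ∈ p.1.support then z (lab p.1) ^ p.2 else 1 with hg
  set gT : X.IdealSheafData × ℕ → X.presheaf.stalk y := fun p => if p.1 ∈ T then z (lab p.1) ^ p.2 else 1 with hgT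
  set gO : X.IdealSheafData × ℕ → X.presheaf.stalk y := fun p => if p.1 ∈ T then 1 else g p with hgO
  have hm₀ : stalkIdeal (monomialIdeal E) y = Ideal.span {(E.map g).prod} :=
    stalkIdeal_monomialIdeal_eq_span_prod hlab E hE
  have hsplit : (E.map g).prod = (E.map gT).prod * (E.map gO).prod := by
    rw [← List.prod_map_mul]
    congr 1
    refine List.map_congr_left fun p hp => ?_
    by_cases hp1 : p.1 ∈ T
    · simp only [hg, hgT, hgO, if_pos hp1, if_pos (hyT _ hp1), mul_one]
    · simp only [hgT, hgO, if_neg hp1, one_mul]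
  set A : Fin T.card → ℕ := fun l => expOf E (σT.symm l).1 with hA
  have hTprod : (E.map gT).prod = ∏ l, (z ∘ e) l ^ A l := by
    rw [hgT, prod_map_pow_ite_mem_eq E T (fun K => z (lab K)),
      ← Finset.prod_coe_sort T (fun K => z (lab K) ^ expOf E K)]
    exact Fintype.prod_equiv σT _ _ fun K => by rw [hce K]; simp only [hA, Equiv.symm_apply_apply]
  have hAsum : ∑ l, A l = weightOf E T := by
    rw [← sum_expOf_eq_weightOf E T, ← Finset.sum_coe_sort T (fun K => expOf E K)]
    exact (Fintype.sum_equiv σT (fun K : ↥T => expOf E K.1) A fun K => by simp only [hA, Equiv.symm_apply_apply]).symm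
  have hAlH : A lH = 0 := by
    simp only [hA, hlH, Equiv.symm_apply_apply]
    exact expOf_eq_zero_of_labels fun q hq hqH =>
      (hP.label_eq_zero hq hqH).resolve_right (Set.nonempty_iff_ne_empty.mp ⟨y, hyH⟩)
  -- the exponent vector `b ≤ A` of degree `n`
  obtain ⟨B, hBA, hBsum⟩ := exists_le_sum_eq A (r := n) (hAsum ▸ hmT)
  have hBlH : B lH = 0 := Nat.eq_zero_of_le_zero (hAlH ▸ hBA lH)
  have hAB : ∏ l, (z ∘ e) l ^ A l = (∏ l, (z ∘ e) l ^ B l) * ∏ l, (z ∘ e) l ^ (A l - B l) := by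
    rw [← Finset.prod_mul_distrib]
    exact Finset.prod_congr rfl fun l _ => by rw [← pow_add, Nat.add_sub_cancel' (hBA l)]
  -- normalise the generators: `h ~ c l_H`, `m ~ ∏ g`
  obtain ⟨w, hw⟩ := Ideal.span_singleton_eq_span_singleton.mp (hHx.symm.trans hHc)
  obtain ⟨w', hw'⟩ := Ideal.span_singleton_eq_span_singleton.mp (hm₀.symm.trans hMx)
  set b : Fin T.card →₀ ℕ := Finsupp.equivFunOnFinite.symm B with hb
  have hbB : ∀ l, b l = B l := fun l => rfl
  refine ⟨T.card, z ∘ e, lH, b, ↑w ^ n * u * ↑w' * (∏ l, (z ∘ e) l ^ (A l - B l)) * (E.map gO).prod, hz.comp e he, hspan,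
    hHc, by rw [hbB, hBlH], by rw [Finsupp.degree_eq_sum]; simp only [hbB, hBsum], ?_, fun hlt => ?_, fun heq l => ?_⟩
  · have hprod : (b.prod fun l k => (z ∘ e) l ^ k) = ∏ l, (z ∘ e) l ^ B l := by
      rw [Finsupp.prod_fintype _ _ fun l => pow_zero _]
      exact Finset.prod_congr rfl fun l _ => by rw [hbB]
    have hkey : MvPolynomial.eval (z ∘ e) (MvPolynomial.X lH ^ n + MvPolynomial.monomial b
        (↑w ^ n * u * ↑w' * (∏ l, (z ∘ e) l ^ (A l - B l)) * (E.map gO).prod)) = ↑w ^ n * (h ^ n + u * m) := by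
      rw [map_add, map_pow, MvPolynomial.eval_X, MvPolynomial.eval_monomial, hprod, mul_add, ← mul_pow, mul_comm _ h, hw,
        ← hw', hsplit, hTprod, hAB]
      ring
    rw [hkey, hIx]
    exact Ideal.mul_mem_left _ _ (Ideal.mem_span_singleton_self _)
  · -- HEAVY: some exponent `A l − B l` is positive, and `c_l ∈ 𝔪_y`
    obtain ⟨l, hl⟩ : ∃ l, B l < A l := by
      by_contra hno
      push Not at hno
      have : ∑ l, A l ≤ ∑ l, B l := Finset.sum_le_sum fun l _ => hno l
      omega
    have hc𝔪 : (z ∘ e) l ^ (A l - B l) ∈ maximalIdeal (X.presheaf.stalk y) :=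
      Ideal.pow_mem_of_mem _ ((hz.comp e he).mem_maximalIdeal l) _ (Nat.sub_pos_of_lt hl)
    have hP𝔪 : ∏ l, (z ∘ e) l ^ (A l - B l) ∈ maximalIdeal (X.presheaf.stalk y) := by
      rw [← Finset.mul_prod_erase _ _ (Finset.mem_univ l)]
      exact Ideal.mul_mem_right _ _ hc𝔪
    exact Ideal.mul_mem_right _ _ (Ideal.mul_mem_left _ _ hP𝔪)
  · -- TIGHT: `Σ B = n = Σ A` with `B ≤ A` forces `B = A`, the vector of `E`-exponents on `T`
    have hBA' : ∀ l ∈ (Finset.univ : Finset (Fin T.card)), B l = A l :=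
      (Finset.sum_eq_sum_iff_of_le fun l _ => hBA l).mp (by rw [hBsum, hAsum, heq])
    exact ⟨(σT.symm l).1, (σT.symm l).2, by rw [hbB, hBA' l (Finset.mem_univ l)]⟩

set_option maxHeartbeats 400000 in
/-- **THE SAFE-FACE GUARD.**  For a `ncHypShapeF n`-datum (`n ≠ 0`) and the blow-up `π` of a SAFE face through `H` of weight
`≥ n`: at every point `x'` OVER THE CENTRE and OFF `V(H')` (any residue field), `𝓘'_{x'} ⊄ 𝔪_{x'}²` — the near-point bound (T10c)
fed with the fibre form (`exists_fibre_data'`) and the heavy ∨ tame ∨ wild fibre guard `fibreForm_notMem_sq'` (T15).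
[new] [cite: CossartPiltant2008, Prop. 4.2 (a)] [cite: Kollar2007, (3.111) Step 3] -/
theorem ncHypShapeF.not_stalkIdeal_transform_le_sq (hEs : HasSNC (H :: boundaryOf E)) (hT : ∀ K ∈ T, K ∈ H :: boundaryOf E)
    (hHT : H ∈ T) (hπ : IsBlowup π (T.sup id)) (hmT : n ≤ weightOf E T) (hn : n ≠ 0) (hsafe : SafeFace n X E T)
    (hP : ncHypShapeF n X E H M) {x' : X'} (hxC : π x' ∈ (T.sup id).support)
    (hx' : x' ∉ (strictTransformIdeal π (T.sup id) H).support) :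
    ¬ stalkIdeal (M.transform π (T.sup id)).ideal x' ≤ maximalIdeal (X'.presheaf.stalk x') ^ 2 := by
  classical
  haveI : IsProper π := hπ.isProper
  haveI : IsLocallyNoetherian X' := LocallyOfFiniteType.isLocallyNoetherian π
  obtain ⟨k, c, lH, b, a, hc, hcspan, hHc, hblH, hbn, hFJ, hheavy, htight⟩ := hP.exists_fibre_data' hEs hT hHT hmT hxC
  have hyT : ∀ K ∈ T, π x' ∈ K.support := (mem_support_finsetSup_iff T (π x')).mp hxC
  have hsafe' : a ∈ maximalIdeal _ ∨ IsUnit ((n : ℕ) : X.presheaf.stalk (π x')) ∨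
      ∀ l, b l = 0 ∨ IsUnit ((b l : ℕ) : X.presheaf.stalk (π x')) := by
    rcases hsafe with hlt | hunit | hlab
    · exact Or.inl (hheavy hlt)
    · exact Or.inr (Or.inl (hunit _))
    · rcases hmT.lt_or_eq with hlt | heq
      · exact Or.inl (hheavy hlt)
      · refine Or.inr (Or.inr fun l => ?_)
        obtain ⟨K, hK, hbl⟩ := htight heq.symm l
        rcases hlab K hK (π x') (hyT K hK) with h0 | hu
        · exact Or.inl (by rw [hbl, h0])
        · exact Or.inr (by rw [hbl]; exact hu)
  rw [MarkedIdeal.transform_ideal, hP.mult_eq]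
  refine IsBlowup.not_stalkIdeal_controlledTransform_le_pow_of_fibre hπ c hcspan (IsRsopPart.isQuasiRegular' hc)
    (IsRsopPart.mem_maximalIdeal hc) ((MvPolynomial.isHomogeneous_X_pow lH n).add (MvPolynomial.isHomogeneous_monomial _ hbn))
    hFJ 2 {lH} (fun l hl => ?_) fun j 𝔮 _ h𝔮 => fibreForm_notMem_sq' hn lH b hblH hbn a hsafe' j 𝔮 h𝔮
  rw [Set.mem_singleton_iff.mp hl]
  exact map_stalkIdeal_finsetSup_eq_span_of_not_mem hEs hT hHT hπ hx' hHc

/-- **`supp M' ⊆ V(H')` after a SAFE face round, for `n ≥ 2`** (off the centre: local isomorphism and `V(H)` lifts; over the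
centre: the safe-face guard). [new] [cite: CossartPiltant2008, Prop. 4.2 (a)] -/
theorem ncHypShapeF.support_transform_subset_of_safe (hEs : HasSNC (H :: boundaryOf E))
    (hT : ∀ K ∈ T, K ∈ H :: boundaryOf E) (hHT : H ∈ T) (hπ : IsBlowup π (T.sup id)) (hmT : n ≤ weightOf E T) (hn : 2 ≤ n)
    (hsafe : SafeFace n X E T) (hP : ncHypShapeF n X E H M) :
    (M.transform π (T.sup id)).support ⊆ ((strictTransformIdeal π (T.sup id) H).support : Set X') := by
  haveI : IsProper π := hπ.isProper
  haveI : IsLocallyNoetherian X' := LocallyOfFiniteType.isLocallyNoetherian π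
  intro x' hx'
  have hx'' : x' ∈ (M.transform π (T.sup id)).support := hx'
  by_cases hxC : π x' ∈ (T.sup id).support
  · by_contra hxH
    refine hP.not_stalkIdeal_transform_le_sq hEs hT hHT hπ hmT (by omega) hsafe hxC hxH ?_
    have h := (MarkedIdeal.mem_support_iff _ _).mp hx''
    rw [MarkedIdeal.transform_mult, hP.mult_eq] at h
    exact h.trans (Ideal.pow_le_pow_right hn)
  · exact mem_support_strictTransformIdeal_of_not_mem hxC
      (hP.support_subset ((hπ.mem_support_transform_iff_of_not_mem M hxC).mp hx''))

/-- ★ **THE SAFE-FACE ROUND LEMMA**: the unit-free hypersurface shape survives the blow-up of a SAFE face through `H` of weight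
`≥ n` (`n ≥ 2`). [new] [cite: Kollar2007, (3.111) Step 3] [cite: CossartPiltant2008, Prop. 4.2 (a)] -/
theorem ncHypShapeF.transform_of_safe (hEs : HasSNC (H :: boundaryOf E)) (hT : ∀ K ∈ T, K ∈ H :: boundaryOf E) (hHT : H ∈ T)
    (hπ : IsBlowup π (T.sup id)) (hmT : n ≤ weightOf E T) (hn : 2 ≤ n) (hsafe : SafeFace n X E T)
    (hP : ncHypShapeF n X E H M) :
    ncHypShapeF n X' (transformExp E π T n) (strictTransformIdeal π (T.sup id) H) (M.transform π (T.sup id)) :=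
  hP.transform_of_support_subset hEs hT hHT hπ hmT (hP.support_transform_subset_of_safe hEs hT hHT hπ hmT hn hsafe)

-- T13's TAME round lemma as the middle disjunct of `SafeFace` (consistency check; unit-free conclusion).
example (hEs : HasSNC (H :: boundaryOf E)) (hT : ∀ K ∈ T, K ∈ H :: boundaryOf E) (hHT : H ∈ T)
    (hπ : IsBlowup π (T.sup id)) (hmT : n ≤ weightOf E T) (hn : 2 ≤ n) (hP : ncHypShape n X E H M) :
    ncHypShapeF n X' (transformExp E π T n) (strictTransformIdeal π (T.sup id) H) (M.transform π (T.sup id)) :=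
  (ncHypShapeF.of_ncHypShape hP).transform_of_safe hEs hT hHT hπ hmT hn (Or.inr (Or.inl hP.isUnit_natCast))

end Fibre

/-! ### §Bridge — from the tree's `IsNCHypStage`, in ANY characteristic -/

section Bridge

open AlgebraicGeometry.Scheme.IdealSheafData (vanishingIdeal)

variable {Y : Scheme.{0}}

/-- **THE BRIDGE, unit-free** (T10's `ncHypShape_of_frame` minus the unit): an s.n.c. frame `F` on the stage `(Y, M.ideal)` in the
hypersurface shape with `SuppLE` yields `ncHypShapeF n Y E 𝓘(H) M` for `E := (𝓘(H), 0) :: F.expList`, with `𝓘(H) ∈ boundaryOf E`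
and `HasSNC (𝓘(H) :: boundaryOf E)`. [folklore] -/
theorem ncHypShapeF_of_frame [IsNoetherian Y] (hY : Scheme.IsRegular Y) {n : ℕ} {M : MarkedIdeal Y} (hμ : M.mult = n)
    {F : NCFrame ⟨Y, M.ideal⟩} (hS : F.IsSNC) (hF : F.HypShape n) (hSupp : F.SuppLE n) :
    vanishingIdeal F.H ∈ boundaryOf ((vanishingIdeal F.H, 0) :: F.expList) ∧
      HasSNC (vanishingIdeal F.H :: boundaryOf ((vanishingIdeal F.H, 0) :: F.expList)) ∧
      ncHypShapeF n Y ((vanishingIdeal F.H, 0) :: F.expList) (vanishingIdeal F.H) M := by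
  refine ⟨List.mem_cons_self, hS.hasSNC_of_forall_mem hY fun K hK => ?_, hμ, ?_, ?_, ?_⟩
  · have hK : K = vanishingIdeal F.H ∨ K ∈ boundaryOf F.expList := by
      simpa only [List.map_cons, List.mem_cons, or_self_left] using hK
    rcases hK with rfl | hK
    · exact ⟨none, rfl⟩
    · obtain ⟨i, rfl⟩ := F.mem_boundaryOf_expList_iff.mp hK
      exact ⟨some i, rfl⟩
  · -- the label clause: the head carries `0`; no `𝓘(Dᵢ)` equals `𝓘(H)`
    intro q hq hqH
    rcases List.mem_cons.mp hq with rfl | hq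
    · exact Or.inl rfl
    · exfalso
      have hq1 : q.1 ∈ boundaryOf F.expList := fst_mem_boundaryOf hq
      obtain ⟨i, hi⟩ := F.mem_boundaryOf_expList_iff.mp hq1
      have hset : ((F.D i : Closeds Y) : Set Y) = (F.H : Set Y) := by
        rw [← Scheme.IdealSheafData.coe_support_vanishingIdeal (Z := F.D i), ← hi, hqH,
          Scheme.IdealSheafData.coe_support_vanishingIdeal]
      exact hS.2.2.2.2.1 i hset.le
  · -- the hypersurface presentation along `V(𝓘(H)) = H`
    intro x hx
    obtain ⟨h, m, u, hu, hh, hm, hI⟩ := hF x (mem_support_vanishingIdeal_iff.mp hx)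
    refine ⟨h, m, u, hu, hh, ?_, hI⟩
    rw [monomialIdeal_cons_zero, NCFrame.monomialIdeal_expList]
    exact hm
  · -- `supp(M) ⊆ V(𝓘(H))`
    intro x hx
    rw [SetLike.mem_coe, mem_support_vanishingIdeal_iff]
    refine hSupp x ((le_idealOrder_iff M.ideal x n).mpr ?_)
    have := (MarkedIdeal.mem_support_iff M x).mp hx
    rwa [hμ] at this

/-- **THE BRIDGE from the binders of `WORNCHyp n`, in any characteristic**: a base `n`-datum whose stage is a hypersurface-shape
labelled n.c. stage with frame `F` is a `ncHypShapeF n`-datum for `E := (𝓘(H), 0) :: F.expList`, `H := 𝓘(F.H)`. [folklore] -/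
theorem ncHypShapeF_of_isBase {k : Type} [Field k] (g : Y ⟶ Spec (.of k)) (hB : IsBase Y g) {n : ℕ} {M : MarkedIdeal Y}
    (hM : IsDatum n M) {F : NCFrame ⟨Y, M.ideal⟩} (hS : F.IsSNC) (hF : F.HypShape n) (hSupp : F.SuppLE n) :
    vanishingIdeal F.H ∈ boundaryOf ((vanishingIdeal F.H, 0) :: F.expList) ∧
      HasSNC (vanishingIdeal F.H :: boundaryOf ((vanishingIdeal F.H, 0) :: F.expList)) ∧
      ncHypShapeF n Y ((vanishingIdeal F.H, 0) :: F.expList) (vanishingIdeal F.H) M := by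
  haveI := hB.locallyOfFiniteType
  haveI := hB.quasiCompact
  haveI : IsLocallyNoetherian Y := LocallyOfFiniteType.isLocallyNoetherian g
  haveI : CompactSpace Y := QuasiCompact.compactSpace_of_compactSpace g
  haveI : IsNoetherian Y := {}
  exact ncHypShapeF_of_frame hB.isRegular hM.1 hS hF hSupp

/-- the exponents of an `ofFn` list: a finite sum -/
theorem weightOf_ofFn {X : Scheme.{0}} {r : ℕ} (f : Fin r → X.IdealSheafData × ℕ) (T : Finset X.IdealSheafData) :
    weightOf (List.ofFn f) T = ∑ i, (by classical exact if (f i).1 ∈ T then (f i).2 else 0) := by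
  induction r with
  | zero => simp [weightOf]
  | succ r ih => rw [List.ofFn_succ, weightOf_cons, ih, Fin.sum_univ_succ]

/-- **the exponents of the frame list `(𝓘(H), 0) :: [(𝓘(Dᵢ), aᵢ)]ᵢ` are `0` or labels `aᵢ`** (the `Dᵢ` of an s.n.c. frame have
pairwise distinct ideal sheaves). [folklore] -/
theorem NCFrame.expOf_cons_expList {N : Stage} (F : NCFrame N)
    (hinj : ∀ i j, vanishingIdeal (F.D i) = vanishingIdeal (F.D j) → i = j) (K : N.Y.IdealSheafData) :
    expOf ((vanishingIdeal F.H, 0) :: F.expList) K = 0 ∨ ∃ i, expOf ((vanishingIdeal F.H, 0) :: F.expList) K = F.a i := by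
  have h0 : expOf ((vanishingIdeal F.H, 0) :: F.expList) K = expOf F.expList K := by
    rw [expOf, expOf, weightOf_cons]
    split_ifs <;> simp
  rw [h0, expOf, NCFrame.expList, weightOf_ofFn]
  by_cases hex : ∃ i, vanishingIdeal (F.D i) = K
  · obtain ⟨i, hi⟩ := hex
    refine Or.inr ⟨i, ?_⟩
    rw [Finset.sum_eq_single i (fun j _ hji => ?_) (fun h => absurd (Finset.mem_univ i) h), if_pos]
    · exact Finset.mem_singleton.mpr hi
    · rw [if_neg]
      intro hj
      exact hji (hinj j i ((Finset.mem_singleton.mp hj).trans hi.symm))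
  · refine Or.inl (Finset.sum_eq_zero fun j _ => ?_)
    rw [if_neg]
    intro hj
    exact hex ⟨j, Finset.mem_singleton.mp hj⟩

/-- **`p = 0` in every stalk of a scheme over a field of characteristic `p`** (`CharP.cast_eq_zero` through
`k → Γ(Y, 𝒪_Y) → 𝒪_{Y,y}`). [folklore] -/
theorem natCast_stalk_eq_zero_of_charP (p : ℕ) {k : Type} [Field k] [CharP k p] (g : Y ⟶ Spec (.of k)) (y : Y) :
    ((p : ℕ) : Y.presheaf.stalk y) = 0 := by
  let φ : k →+* (Y.presheaf.stalk y : Type _) :=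
    (Y.presheaf.germ ⊤ y trivial).hom.comp (g.appTop.hom.comp (Scheme.ΓSpecIso (.of k)).inv.hom)
  have h := congrArg φ (CharP.cast_eq_zero k p)
  rwa [map_natCast, map_zero] at h

end Bridge

end Summit.ResolutionOfSingularities.ResolutionOfSingularities.Theorems.DeltaCutClasses
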